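import Literature.Probability.LatticeModels.HighDimTrivialityUniformProofs
import HarnessLib

/-!
# The improved tree diagram bound in `d = 4` and its two-point-function inputs (Aizenman–Duminil-Copin 2021, Thm 1.3, Lemma 6.3, Thm 5.6)

Topic `Literature/Probability/LatticeModels`; family `crit-ising` (crit-ising.S13). First layer
of the decomposition of the tree's named fact `aizenmanDuminilCopin_ursellFourSum_le`
(`HighDimTrivialityMoments`: `Σ_L⁻² ∑_{Λ_{rL}⁴} |U₄| ≤ C r¹² (log L)^{-c}` in the critical window
of the four-dimensional model, cited to the *in-proof* display "`S(L,r,β) ≤ C₂ r¹² (log log L /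
log L)^c`" of Aizenman–Duminil-Copin 2021, §6.3, p. 26) into the numbered theorems of

* M. Aizenman, H. Duminil-Copin, *Marginal triviality of the scaling limits of critical 4D Ising
  and `φ⁴₄` models*, Ann. of Math. **194** (2021) 163–235 = arXiv:1912.07973 ("ADC"):
  **Theorem 1.3** (improved tree diagram bound, p. 6), **Lemma 6.3** (growth of the bubble
  diagram, p. 21) and **Theorem 5.6** (sliding-scale infrared bound, p. 18),

from which §6.3 (pp. 26–27, the bounds on the sums (1)–(4)) derives that display using in
addition only the infrared bound, the Messager–Miracle-Solé inequality and lattice sums (all in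
the tree or elementary). This file records the three theorems as named facts (D-0014), with the
two quantities they are about; the §6.3 computation is the business of the sibling proof file
`ImprovedTreeDiagramBoundSum` (to come).

## Contents

* `boxSusceptibility S L = χ_L = ∑_{x ∈ Λ_L} S(x)` and `bubbleDiagram S L = B_L = ∑_{x ∈ Λ_L} S(x)²`
  for a function `S` on `ℤ^d` (the two-point function `S(x) = ⟨σ₀σ_x⟩` of a state), with the
  elementary API (`_nonneg`, `_mono`, `one_le_bubbleDiagram`, `bubbleDiagram_le_boxSusceptibility`).
* Named facts: `aizenmanDuminilCopin_improvedTreeDiagramBound` (Thm 1.3),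
  `aizenmanDuminilCopin_bubbleDiagram_growth` (Lemma 6.3, in the form its proof establishes:
  integer scales, dyadic-shell count `1 + log(L/ℓ)`),
  `aizenmanDuminilCopin_slidingScaleInfraredBound` (Thm 5.6, Ising case).

## Conventions

As in `HighDimTriviality*`: statements are about the DLR states `μ ∈ 𝒢(β, 0) =
isingGibbsMeasures d β 0` with `0 ≤ β ≤ β_c` (a singleton), two-point functions are
`twoPoint μ spinAt u v = ∫ σ_u σ_v dμ` (`Correlations`), `S(x) = twoPoint μ spinAt 0 x`,
boxes are `Λ_L = latticeBox d L = [-L, L]^d ∩ ℤ^d` for real `L`, distances on `ℤ^d` are in the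
sup norm (`Site.norm_eq_supNorm`; the printed "distance larger than `L`" in any fixed norm is
implied up to the constants, and the sup-norm hypothesis is the weaker one), and the critical
window "`L ≤ ξ(β)`" is written, as in `aizenmanDuminilCopin_mgf_normalizedField_bound`, as
`β = β_c ∨ (0 < β ∧ L · ξ(β)⁻¹ ≤ 1)` with `ξ⁻¹ = invCorrLength (twoPointPlus 4 β)`
(`ξ(β_c) = +∞`, ADC §1.3). Real powers are `Real.rpow`.

## Mathlib

`Finset.sum` over `Fintype.piFinset`/`latticeBox`, `tsum`/`Summable`, `Real.log`, `Real.rpow`.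
Mathlib has no Ising model, bubble diagram or susceptibility.
-/

noncomputable section

open MeasureTheory Finset Filter Topology

namespace Literature.Probability.LatticeModels

variable {d : ℕ}

/-! ### The truncated susceptibility `χ_L` and the bubble diagram `B_L` -/

/-- **The susceptibility truncated at distance `L`**, `χ_L = ∑_{x ∈ Λ_L} S(x)` for a function
`S` on `ℤ^d` (the two-point function `S(x) = ⟨σ₀σ_x⟩_β` of a state; Aizenman–Duminil-Copin
2021, §5.3, display before Theorem 5.6: "`χ_L(ρ,β) := ∑_{x ∈ Λ_L} S_{ρ,β}(x)`"; Panis 2023,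
§3). Empty sum `0` for `L < 0`. [cite: AizenmanDuminilCopinAnnals2021, arXiv:1912.07973 §5.3, definition of χ_L before Thm 5.6 (p. 18)] -/
def boxSusceptibility (S : Site d → ℝ) (L : ℝ) : ℝ := ∑ x ∈ latticeBox d L, S x

/-- **The bubble diagram truncated at distance `L`**, `B_L = ∑_{x ∈ Λ_L} S(x)²`
(Aizenman–Duminil-Copin 2021, Theorem 1.3: "`B_L(β)` is the bubble diagram truncated at a
distance `L` defined by the formula `B_L(β) := ∑_{x ∈ Λ_L} ⟨σ₀σ_x⟩_β²`"). Empty sum `0` for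
`L < 0`. [cite: AizenmanDuminilCopinAnnals2021, arXiv:1912.07973 Thm 1.3, definition of B_L(β) (p. 6)] -/
def bubbleDiagram (S : Site d → ℝ) (L : ℝ) : ℝ := ∑ x ∈ latticeBox d L, S x ^ 2

/-- Unfolding `χ_L`. [folklore] -/
theorem boxSusceptibility_def (S : Site d → ℝ) (L : ℝ) :
    boxSusceptibility S L = ∑ x ∈ latticeBox d L, S x := rfl

/-- Unfolding `B_L`. [folklore] -/
theorem bubbleDiagram_def (S : Site d → ℝ) (L : ℝ) :
    bubbleDiagram S L = ∑ x ∈ latticeBox d L, S x ^ 2 := rfl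

/-- `B_L ≥ 0`. [folklore] -/
theorem bubbleDiagram_nonneg (S : Site d → ℝ) (L : ℝ) : 0 ≤ bubbleDiagram S L :=
  Finset.sum_nonneg fun _ _ => sq_nonneg _

/-- `χ_L ≥ 0` for a non-negative two-point function (Griffiths' first inequality). [folklore] -/
theorem boxSusceptibility_nonneg {S : Site d → ℝ} (hS : ∀ x, 0 ≤ S x) (L : ℝ) :
    0 ≤ boxSusceptibility S L :=
  Finset.sum_nonneg fun x _ => hS x

/-- `B_L` is non-decreasing in `L`. [folklore] -/
theorem bubbleDiagram_mono (S : Site d → ℝ) {L L' : ℝ} (h : L ≤ L') :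
    bubbleDiagram S L ≤ bubbleDiagram S L' :=
  Finset.sum_le_sum_of_subset_of_nonneg (latticeBox_mono h) fun _ _ _ => sq_nonneg _

/-- `χ_L` is non-decreasing in `L` for a non-negative two-point function. [folklore] -/
theorem boxSusceptibility_mono {S : Site d → ℝ} (hS : ∀ x, 0 ≤ S x) {L L' : ℝ} (h : L ≤ L') :
    boxSusceptibility S L ≤ boxSusceptibility S L' :=
  Finset.sum_le_sum_of_subset_of_nonneg (latticeBox_mono h) fun x _ _ => hS x

/-- The origin lies in `Λ_L` for `L ≥ 0`. [folklore] -/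
theorem zero_mem_latticeBox {L : ℝ} (hL : 0 ≤ L) : (0 : Site d) ∈ latticeBox d L := by
  rw [mem_latticeBox]
  intro i
  simpa using hL

/-- `B_L ≥ S(0)²` for `L ≥ 0`; in particular `B_L ≥ 1` for the two-point function of a spin
system (`S(0) = ⟨σ₀²⟩ = 1`), the normalisation behind "`B_L(β)^{-c} ≤ 1`" (Aizenman–Duminil-Copin
2021, §6.3, "we simply use that `B_{L(x₁,…,x₄)}(β) ≥ 1`"). [cite: AizenmanDuminilCopinAnnals2021, arXiv:1912.07973 §6.3, bound on (3) (p. 27)] -/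
theorem sq_apply_zero_le_bubbleDiagram (S : Site d → ℝ) {L : ℝ} (hL : 0 ≤ L) :
    S 0 ^ 2 ≤ bubbleDiagram S L := by
  rw [bubbleDiagram]
  exact Finset.single_le_sum (f := fun x => S x ^ 2) (fun _ _ => sq_nonneg _) (zero_mem_latticeBox hL)

/-- `B_L ≥ 1` for `L ≥ 0` when `S(0) = 1` (Aizenman–Duminil-Copin 2021, §6.3, "`B_{L(x₁,…,x₄)}(β) ≥ 1`"). [cite: AizenmanDuminilCopinAnnals2021, arXiv:1912.07973 §6.3, bound on (3) (p. 27)] -/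
theorem one_le_bubbleDiagram {S : Site d → ℝ} (h0 : S 0 = 1) {L : ℝ} (hL : 0 ≤ L) :
    1 ≤ bubbleDiagram S L := by
  simpa [h0] using sq_apply_zero_le_bubbleDiagram S hL

/-- `B_L ≤ χ_L` when `0 ≤ S ≤ 1` (as for `S(x) = ⟨σ₀σ_x⟩`, `|⟨σ₀σ_x⟩| ≤ 1`). [folklore] -/
theorem bubbleDiagram_le_boxSusceptibility {S : Site d → ℝ} (hS0 : ∀ x, 0 ≤ S x)
    (hS1 : ∀ x, S x ≤ 1) (L : ℝ) : bubbleDiagram S L ≤ boxSusceptibility S L := by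
  refine Finset.sum_le_sum fun x _ => ?_
  calc S x ^ 2 = S x * S x := sq _
    _ ≤ S x * 1 := mul_le_mul_of_nonneg_left (hS1 x) (hS0 x)
    _ = S x := mul_one _

/-! ### The three printed theorems (named facts) -/

/-- **NAMED FACT — Aizenman–Duminil-Copin 2021, Theorem 1.3 (improved tree diagram bound).**
"For the n.n.f. Ising model in dimension `d = 4`, there exist `c, C > 0` such that for every
`β ≤ β_c`, every `L ≤ ξ(β)` and every `x, y, z, t ∈ ℤ^d` at a distance larger than `L` of each
other, `|U₄^β(x,y,z,t)| ≤ (C / B_L(β)^c) ∑_{u ∈ ℤ⁴} ⟨σ_uσ_x⟩_β ⟨σ_uσ_y⟩_β ⟨σ_uσ_z⟩_β ⟨σ_uσ_t⟩_β`,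
where `B_L(β)` is the bubble diagram truncated at a distance `L` defined by the formula
`B_L(β) := ∑_{x ∈ Λ_L} ⟨σ₀σ_x⟩_β²`" (Ann. of Math. 194 (2021), Thm 1.3, p. 6 of arXiv:1912.07973;
`U₄` the four-point Ursell function (1.20) = `connectedFour`; proof: §4 under the power-law
assumption, §6.1 unconditionally, from the intersection-clustering bound Prop. 6.1 and the
random-current representation). Vendored for the DLR states `μ ∈ 𝒢(β, 0)` on `ℤ⁴`,
`0 ≤ β ≤ β_c(4)` (a singleton; two-point functions `twoPoint μ spinAt`, `S(x) = ⟨σ₀σ_x⟩_μ`),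
every real `L > 0` in the window `L ≤ ξ(β)` (`ξ(β_c) = ∞`; for `L < 1`, `Λ_L = {0}` and
`B_L = 1`, where the display is the tree diagram bound of [Aiz82] up to the constant), points at
mutual **sup-norm** distance `> L`, and — since the printed right-hand side is an infinite
series — under the hypothesis that `u ↦ ∏ᵢ ⟨σ_uσ_{xᵢ}⟩` is summable (at `β_c` in `d = 4` it is,
by the infrared bound; the hypothesis only weakens the statement), with the series as a real
`tsum` and `B_L(β)^{-c}` as `Real.rpow`. Named fact (D-0014).
[cite: AizenmanDuminilCopinAnnals2021, arXiv:1912.07973 Theorem 1.3 (p. 6); proof §4 and §6.1] -/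
def aizenmanDuminilCopin_improvedTreeDiagramBound : Prop :=
  ∃ c C : ℝ, 0 < c ∧ 0 < C ∧
    ∀ (β L : ℝ), 0 ≤ β → β ≤ criticalBeta 4 → 0 < L →
      (β = criticalBeta 4 ∨ (0 < β ∧ L * invCorrLength (twoPointPlus 4 β) ≤ 1)) →
    ∀ μ ∈ isingGibbsMeasures 4 β 0, ∀ x : Fin 4 → Site 4,
      (∀ i j, i ≠ j → L < ‖x i - x j‖) →
      Summable (fun u : Site 4 => ∏ i, twoPoint μ spinAt u (x i)) →
      |connectedFour μ spinAt x| ≤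
        C / bubbleDiagram (twoPoint μ spinAt 0) L ^ c * ∑' u : Site 4, ∏ i, twoPoint μ spinAt u (x i)

/-- **NAMED FACT — Aizenman–Duminil-Copin 2021, Lemma 6.3 (growth of the bubble diagram), in
the form its proof establishes.** Printed: "For `d = 4`, there exists `C > 0` such that for every
`β ≤ β_c` and every `ℓ ≤ L ≤ ξ(β)`, `B_L(β) ≤ (1 + C log(L/ℓ) / log ℓ) B_ℓ(β)`"
(arXiv:1912.07973, Lemma 6.3, p. 21). The scales there are integers (§6.1 works with "a
(possibly finite) sequence `𝓛` of integers `ℓ_k`"; the lemma's only use, p. 21, has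
`L ≥ ℓ³`), and the printed proof controls whole dyadic shells: "there are `log₂(L/ℓ)` scales
between `ℓ` and `L`, and at least `(1/C) log₂ ℓ` regular scales between `1` and `ℓ` … Since the
sums of squared correlations on any of the former contribute less to `B_L(β) - B_ℓ(β)` than any
of the latter to `B_ℓ(β)`, we deduce `B_L(β) ≤ (1 + C log₂(L/ℓ)/log₂ ℓ) B_ℓ(β)`" — the number of
dyadic shells meeting `[ℓ, L]` being `⌈log₂(L/ℓ)⌉ ≤ 1 + log₂(L/ℓ)`, what the argument yields is
`B_L ≤ (1 + C (1 + log(L/ℓ)) / log ℓ) B_ℓ` (constants in any fixed base absorbed in `C`). Read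
literally for consecutive integers `L = ℓ + 1` (a fortiori for real scales, where
`Λ_ℓ = Λ_{⌊ℓ⌋}` makes it false: `B_2 ≤ B_1` in the limit `ℓ → 2⁻`), the display would assert
`B_{ℓ+1} - B_ℓ ≤ C log(1 + 1/ℓ)/log ℓ · B_ℓ ≈ C B_ℓ/(ℓ log ℓ)`, a factor `ℓ` beyond the one-shell
bound the proof gives; **this file vendors the proof-supported form** (the two agree up to a
factor `2` whenever `L ≥ 2ℓ`, in particular in every use made of the lemma in the paper and in
§6.3), for the DLR states `μ ∈ 𝒢(β, 0)` on `ℤ⁴`, `0 ≤ β ≤ β_c(4)`, integer scales `2 ≤ ℓ ≤ L`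
(`log ℓ > 0`) with `L` in the window `L ≤ ξ(β)`, `B_L = bubbleDiagram (⟨σ₀σ_·⟩_μ) L`. Named fact
(D-0014). [cite: AizenmanDuminilCopinAnnals2021, arXiv:1912.07973 Lemma 6.3 and its proof (p. 21)] -/
def aizenmanDuminilCopin_bubbleDiagram_growth : Prop :=
  ∃ C : ℝ, 0 < C ∧
    ∀ (β : ℝ) (ℓ L : ℕ), 0 ≤ β → β ≤ criticalBeta 4 → 2 ≤ ℓ → ℓ ≤ L →
      (β = criticalBeta 4 ∨ (0 < β ∧ (L : ℝ) * invCorrLength (twoPointPlus 4 β) ≤ 1)) →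
    ∀ μ ∈ isingGibbsMeasures 4 β 0,
      bubbleDiagram (twoPoint μ spinAt 0) L ≤
        (1 + C * (1 + Real.log ((L : ℝ) / ℓ)) / Real.log ℓ) * bubbleDiagram (twoPoint μ spinAt 0) ℓ

/-- **NAMED FACT — Aizenman–Duminil-Copin 2021, Theorem 5.6 (sliding-scale infrared bound),
Ising case.** "There exists a constant `C = C(d) > 0` such that for every n.n.f. model on `ℤ^d`
(`d > 2`), every `β ≤ β_c(ρ)` and `L ≥ ℓ ≥ 1`, `χ_L(ρ,β) / L² ≤ (C/β) χ_ℓ(ρ,β) / ℓ²`", with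
`χ_L(ρ,β) := ∑_{x ∈ Λ_L} S_{ρ,β}(x)`, `S_{ρ,β}(x) = ⟨τ₀τ_x⟩_{ρ,β}` the infinite-volume two-point
function (arXiv:1912.07973, Thm 5.6, p. 18; stated for single-spin distributions `ρ` in the
Griffiths–Simon class, of which the Ising spin is the basic member; proof by the spectral
representation, Prop. 5.3–5.4 and Cor. 5.5, for `β < β_c`, extended to `β_c` by the continuity
of [AizDumSid15]). Vendored for the nearest-neighbour Ising model on `ℤ^d`, `d ≥ 3`, the DLR
states `μ ∈ 𝒢(β, 0)` with `0 < β ≤ β_c(d)`, real `1 ≤ ℓ ≤ L`, `χ_L = boxSusceptibility (⟨σ₀σ_·⟩_μ) L`.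
Named fact (D-0014). [cite: AizenmanDuminilCopinAnnals2021, arXiv:1912.07973 Theorem 5.6 (p. 18)] -/
def aizenmanDuminilCopin_slidingScaleInfraredBound : Prop :=
  ∀ {d : ℕ}, 3 ≤ d → ∃ C : ℝ, 0 < C ∧
    ∀ (β ℓ L : ℝ), 0 < β → β ≤ criticalBeta d → 1 ≤ ℓ → ℓ ≤ L →
    ∀ μ ∈ isingGibbsMeasures d β 0,
      boxSusceptibility (twoPoint μ spinAt 0) L / L ^ 2 ≤
        C / β * (boxSusceptibility (twoPoint μ spinAt 0) ℓ / ℓ ^ 2)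

/-! ### Elementary consequences -/

/-- The doubling form of the sliding-scale infrared bound: `χ_{2ℓ} ≤ (4C/β) χ_ℓ` for `ℓ ≥ 1`
(Aizenman–Duminil-Copin 2021, Thm 5.6 with `L = 2ℓ`). [cite: AizenmanDuminilCopinAnnals2021, arXiv:1912.07973 Theorem 5.6 (p. 18)] -/
theorem boxSusceptibility_two_mul_le (h : aizenmanDuminilCopin_slidingScaleInfraredBound) (hd : 3 ≤ d) :
    ∃ C : ℝ, 0 < C ∧ ∀ (β ℓ : ℝ), 0 < β → β ≤ criticalBeta d → 1 ≤ ℓ →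
      ∀ μ ∈ isingGibbsMeasures d β 0,
        boxSusceptibility (twoPoint μ spinAt 0) (2 * ℓ) ≤
          4 * C / β * boxSusceptibility (twoPoint μ spinAt 0) ℓ := by
  obtain ⟨C, hC, H⟩ := h hd
  refine ⟨C, hC, fun β ℓ hβ hβc hℓ μ hμ => ?_⟩
  have hℓ0 : 0 < ℓ := one_pos.trans_le hℓ
  have key := H β ℓ (2 * ℓ) hβ hβc hℓ (by linarith) μ hμ
  rw [div_le_iff₀ (by positivity)] at key
  calc boxSusceptibility (twoPoint μ spinAt 0) (2 * ℓ)
      ≤ C / β * (boxSusceptibility (twoPoint μ spinAt 0) ℓ / ℓ ^ 2) * (2 * ℓ) ^ 2 := key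
    _ = 4 * C / β * boxSusceptibility (twoPoint μ spinAt 0) ℓ := by
        field_simp
        ring

end Literature.Probability.LatticeModels
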